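import Mathlib
import Summits.Ventures.PercRepro2.Defs
import Summits.Ventures.PercRepro2.CoinDefs
import Summits.Ventures.PercRepro2.CoinReverse
import Summits.Ventures.PercRepro2.CoinPendantDefs
import Summits.Ventures.PercRepro2.CoinLsmCoreDefs
import Summits.Ventures.PercRepro2.CoinTreeCore
import Summits.Ventures.PercRepro2.CoinOrTailKDefs
import Summits.Ventures.PercRepro2.CoinK2HeadAwareCore

/-!
# Row 2′DARC at an OR-tail over an OUT-TREE core with two sure entries — ANY head
(blind cell PercRepro2, night-2 g13; proofs/NIGHT2-DARC.md §48)

The corollary of `darc_of_orTailK2` for an out-tree core (`TreeCore`, whose cluster law is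
log-supermodular by `TreeCore.coreLevel_lsm`): two SURE entries `r₁, r₂` of the tail with no
condition on their ancestry, ANY two markers, ANY head beyond `a` — no head-blindness (the core
may have arbitrary arcs into the head) and no non-degeneracy hypothesis.
-/

namespace Summit.Ventures.PercRepro2.Coin

open Classical

section TreeCorollary

variable {V : Type*} {E : Type*} [Fintype V] [DecidableEq V] [Fintype E] [DecidableEq E]
  {R : Type*} [Field R] [LinearOrder R] [IsStrictOrderedRing R]
  {arcs : E → Finset (V × V)} {s : V} {U : Finset V} {ent : Finset V} {c : V → E} {a w : V}

/-- **COROLLARY (out-tree core, any head).**  `U` an out-tree core (`TreeCore`), two sure entries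
`r₁, r₂` of the tail (no condition on their ancestry), ANY two markers, ANY head ⟹ row 2′DARC at
`a → w`. -/
theorem darc_of_orTailTreeK2 (pr : E → R) (hp : IsProbVec pr) (hS : SameEnds arcs)
    (h : OrTailK arcs s U ent c a) {c' : V → E} {par : V → V} {rk : V → ℕ}
    (hT : TreeCore arcs s U c' par rk) {r₁ r₂ m₁ m₂ : V} (hm₁ : m₁ ∈ U) (hm₂ : m₂ ∈ U)
    (hr₁ : r₁ ∈ ent) (hr₂ : r₂ ∈ ent) (hent : ∀ r ∈ ent, r = r₁ ∨ r = r₂)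
    (hsure : ∀ r ∈ ent, pr (c r) = 1)
    {t : V} (htC : t ∉ insert a U) (hts : t ≠ s) (hws : w ≠ s) (hwC : w ∉ insert a U) :
    DARC pr arcs s {t} m₁ m₂ a w :=
  darc_of_orTailK2 pr hp hS h hm₁ hm₂ hr₁ hr₂ hent hsure (hT.coreLevel_lsm pr hp) htC hts hws hwC

end TreeCorollary

end Summit.Ventures.PercRepro2.Coin
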